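import Summits.Parity.BatemanHorn.Theorems.SoloInformedErdosNairClassI
import Summits.Parity.BatemanHorn.Theorems.SoloInformedQuadraticPrimeCount

/-!
# Erdős's bound `∑_{n ≤ N} τ(|g(n)|) ≪ N log N`: small values and Shiu's class II

Solo informed line (Parity / Bateman–Horn), session 139 — fourth file of the unconditional proof of
Erdős's bound (discharging the Nair–Tenenbaum hypothesis of `SoloInformedErdosUpperBoundNT`);
notation as in `SoloInformedErdosNairClassI` (`m_n = |g(n)| = c_n d_n` cut at height `z`, cut prime
`P_n`).  Two of the pieces of `∑_{n ≤ N} τ(m_n)` that are bounded through a pointwise bound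
`τ(m_n) ≤ F` or `τ(m) ≤ m` and a power saving in the count:
* `sum_card_divisors_small_le` — the small values: `∑_{n ∈ s, m_n ≤ z} τ(m_n) ≤ 2 deg g (z+1) z`
  (each value is taken at most `2 deg g` times on `s`, `card_filter_natAbs_eval_eq_le`; `τ(m) ≤ m`);
* `pow_ePow_dvd_of_classII`, `polyClassII_bound` — **class II** (`P_n ≤ w`, `c_n ≤ w`, `w² = z`):
  `P_n^{e} ∣ g(n)` with `P_n^{e} > w` (`e = Shiu.ePow w P_n`), so the class lies in
  `⋃_{P ≤ w} {n ≤ N : P^{e_P} ∣ g(n)}`, counted by `card_Icc_filter_dvd_eval_le` (`ρ_g(p^a) ≤ W`)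
  and `Shiu.sum_inv_pow_ePow_le`: `∑_{II} τ(m_n) ≤ F W (7 N w^{−1/3} + w)`.
Everything is PROVED; no definitions, no named facts.  Classes III–IV and the assembly follow.

References: P. Shiu, J. reine angew. Math. 313 (1980) 161–170, §5 [Shiu1980]; P. Erdős, J. London
Math. Soc. 27 (1952) 7–15 [Erdos1952].
-/

open Finset Real Polynomial

namespace Summit.Parity.BatemanHorn.Theorems

open Literature.NumberTheory.Sieve

namespace ErdosDivisor

/-! ### Small values `|g(n)| ≤ z` -/

/-- **Small values.**  For `g` non-constant and `z ≥ 0`: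
`∑_{n ∈ s, |g(n)| ≤ z} τ(|g(n)|) ≤ 2 deg g · (z + 1) · z` — each value `m ≤ z` is taken at most
`2 deg g` times on `s` (`card_filter_natAbs_eval_eq_le`) and `τ(m) ≤ m ≤ z`. [folklore] -/
theorem sum_card_divisors_small_le (g : ℤ[X]) (hdeg : 0 < g.natDegree) (s : Finset ℕ) {z : ℝ}
    (hz : 0 ≤ z) :
    ∑ n ∈ s.filter (fun n : ℕ => (((g.eval (n : ℤ)).natAbs : ℕ) : ℝ) ≤ z),
        (#((g.eval (n : ℤ)).natAbs.divisors) : ℝ) ≤ 2 * g.natDegree * (z + 1) * z := by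
  classical
  set T := s.filter (fun n : ℕ => (((g.eval (n : ℤ)).natAbs : ℕ) : ℝ) ≤ z) with hT
  have hmaps : ∀ n ∈ T, (g.eval (n : ℤ)).natAbs ∈ range (⌊z⌋₊ + 1) := by
    intro n hn
    rw [hT, mem_filter] at hn
    exact mem_range.2 (Nat.lt_succ_of_le (Nat.le_floor hn.2))
  rw [← sum_fiberwise_of_maps_to hmaps]
  have hinner : ∀ m ∈ range (⌊z⌋₊ + 1),
      ∑ n ∈ T.filter (fun n : ℕ => (g.eval (n : ℤ)).natAbs = m),
        (#((g.eval (n : ℤ)).natAbs.divisors) : ℝ) ≤ 2 * g.natDegree * z := by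
    intro m hm
    have hmz : (m : ℝ) ≤ z := by
      have h1 : m ≤ ⌊z⌋₊ := Nat.lt_succ_iff.1 (mem_range.1 hm)
      exact (Nat.cast_le.2 h1).trans (Nat.floor_le hz)
    have hpt : ∀ n ∈ T.filter (fun n : ℕ => (g.eval (n : ℤ)).natAbs = m),
        (#((g.eval (n : ℤ)).natAbs.divisors) : ℝ) ≤ z := by
      intro n hn
      rw [(mem_filter.1 hn).2]
      exact le_trans (by exact_mod_cast Nat.card_divisors_le_self m) hmz
    have hcard : (#(T.filter (fun n : ℕ => (g.eval (n : ℤ)).natAbs = m)) : ℝ) ≤ 2 * g.natDegree := by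
      exact_mod_cast card_filter_natAbs_eval_eq_le g hdeg T m
    calc ∑ n ∈ T.filter (fun n : ℕ => (g.eval (n : ℤ)).natAbs = m),
          (#((g.eval (n : ℤ)).natAbs.divisors) : ℝ)
        ≤ ∑ n ∈ T.filter (fun n : ℕ => (g.eval (n : ℤ)).natAbs = m), z := sum_le_sum hpt
      _ = #(T.filter (fun n : ℕ => (g.eval (n : ℤ)).natAbs = m)) * z := by
          rw [sum_const, nsmul_eq_mul]
      _ ≤ 2 * g.natDegree * z := mul_le_mul_of_nonneg_right hcard hz
  calc ∑ m ∈ range (⌊z⌋₊ + 1), ∑ n ∈ T.filter (fun n : ℕ => (g.eval (n : ℤ)).natAbs = m),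
        (#((g.eval (n : ℤ)).natAbs.divisors) : ℝ)
      ≤ ∑ m ∈ range (⌊z⌋₊ + 1), 2 * (g.natDegree : ℝ) * z := sum_le_sum hinner
    _ = ((⌊z⌋₊ : ℝ) + 1) * (2 * g.natDegree * z) := by
        rw [sum_const, card_range, nsmul_eq_mul]; push_cast; ring
    _ ≤ (z + 1) * (2 * g.natDegree * z) := by
        have h1 : (⌊z⌋₊ : ℝ) ≤ z := Nat.floor_le hz
        have h2 : 0 ≤ 2 * (g.natDegree : ℝ) * z := by positivity
        nlinarith
    _ = 2 * g.natDegree * (z + 1) * z := by ring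

/-! ### Class II: a large prime-power divisor -/

/-- In class II (`P_n ≤ w`, `c_n ≤ w`, `w² = z < |g(n)|`) the cut prime satisfies
`P_n^{e} ∣ g(n)` with `e = Shiu.ePow w P_n` (`P_n^{v} > w ≥ P_n^{e−1}` since `c_n P_n^{v} > z`).
[cite: Shiu1980, §5 (∑_II)] -/
theorem pow_ePow_dvd_of_classII {g : ℤ[X]} {n : ℕ} {z w : ℝ} (hw : 2 ≤ w) (hwz : w * w = z)
    (hzm : z < (((g.eval (n : ℤ)).natAbs : ℕ) : ℝ))
    (hcw : (Shiu.cPart z (g.eval (n : ℤ)).natAbs : ℝ) ≤ w) :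
    (Shiu.cutPrime z (g.eval (n : ℤ)).natAbs).Prime ∧
      ((Shiu.cutPrime z (g.eval (n : ℤ)).natAbs ^
        Shiu.ePow w (Shiu.cutPrime z (g.eval (n : ℤ)).natAbs) : ℕ) : ℤ) ∣ g.eval (n : ℤ) := by
  set m := (g.eval (n : ℤ)).natAbs with hm
  have hw0 : 0 < w := by linarith
  have hw1 : 1 ≤ w := by linarith
  have hz1 : 1 ≤ z := by nlinarith
  have hm2 : 2 ≤ m := two_le_natAbs_of_lt hz1 hzm
  obtain ⟨hPmem, -⟩ := Shiu.cutPrime_mem hm2 hz1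
  set P := Shiu.cutPrime z m with hP
  have hPp : P.Prime := Nat.prime_of_mem_primeFactors hPmem
  refine ⟨hPp, Int.natCast_dvd.2 ?_⟩
  have hcut := Shiu.lt_cPart_mul_pow hm2 hz1 hzm
  rw [← hP] at hcut
  set t := m.factorization P with ht
  have hPt : w < (P : ℝ) ^ t := by
    by_contra hle
    rw [not_lt] at hle
    have hc0 : (0 : ℝ) ≤ Shiu.cPart z m := Nat.cast_nonneg _
    have : (Shiu.cPart z m : ℝ) * (P : ℝ) ^ t ≤ w * w := mul_le_mul hcw hle (by positivity) hw0.le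
    linarith
  have hlt : Shiu.ePow w P - 1 < t := by
    have h1 : (P : ℝ) ^ (Shiu.ePow w P - 1) < (P : ℝ) ^ t :=
      lt_of_le_of_lt (Shiu.pow_ePow_sub_one_le hw1 P) hPt
    exact (pow_lt_pow_iff_right₀ (by exact_mod_cast hPp.one_lt)).1 h1
  have hle : Shiu.ePow w P ≤ t := by omega
  exact (pow_dvd_pow P hle).trans (Nat.ordProj_dvd m P)

/-- **Class II** (the polynomial analogue of Shiu 1980, §5, `∑_{II}`): if `ρ_g(p^a) ≤ W` at every
prime power, `w ≥ 2`, `w² = z`, and `τ(|g(n)|) ≤ F` on `[1, N]`, then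
`∑_{n ≤ N, |g(n)| > z, P_n ≤ w, c_n ≤ w} τ(|g(n)|) ≤ F · W · (7 N w^{−1/3} + w)`:
the `n` lie in `⋃_{P ≤ w} {n ≤ N : P^{e_P} ∣ g(n)}`, each counted by `card_Icc_filter_dvd_eval_le`
(`≤ ρ_g(P^{e_P})(N/P^{e_P} + 1)`), and `∑_{P ≤ w} P^{−e_P} ≤ 7 w^{−1/3}` (`Shiu.sum_inv_pow_ePow_le`).
[cite: Shiu1980, §5 (∑_II)]; [this work] -/
theorem polyClassII_bound (g : ℤ[X]) {W : ℝ}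
    (hW : ∀ p : ℕ, p.Prime → ∀ a : ℕ, (polyRootCountMod ![g] (p ^ a) : ℝ) ≤ W)
    (N : ℕ) {z w F : ℝ} (hw : 2 ≤ w) (hwz : w * w = z) (hF0 : 0 ≤ F)
    (hF : ∀ n ∈ Icc 1 N, (#((g.eval (n : ℤ)).natAbs.divisors) : ℝ) ≤ F) :
    ∑ n ∈ (Icc 1 N).filter (fun n : ℕ => z < (((g.eval (n : ℤ)).natAbs : ℕ) : ℝ) ∧
        (Shiu.cutPrime z (g.eval (n : ℤ)).natAbs : ℝ) ≤ w ∧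
        (Shiu.cPart z (g.eval (n : ℤ)).natAbs : ℝ) ≤ w),
        (#((g.eval (n : ℤ)).natAbs.divisors) : ℝ) ≤
      F * W * (7 * (N : ℝ) * w ^ (-(1 / 3 : ℝ)) + w) := by
  classical
  set T := (Icc 1 N).filter (fun n : ℕ => z < (((g.eval (n : ℤ)).natAbs : ℕ) : ℝ) ∧
        (Shiu.cutPrime z (g.eval (n : ℤ)).natAbs : ℝ) ≤ w ∧
        (Shiu.cPart z (g.eval (n : ℤ)).natAbs : ℝ) ≤ w) with hT
  have hw0 : 0 < w := by linarith
  have hw1 : 1 ≤ w := by linarith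
  have hW0 : 0 ≤ W := le_trans (Nat.cast_nonneg _) (hW 2 Nat.prime_two 0)
  -- Step 1: `∑ τ ≤ F #T`
  have h1 : ∑ n ∈ T, (#((g.eval (n : ℤ)).natAbs.divisors) : ℝ) ≤ F * #T := by
    calc ∑ n ∈ T, (#((g.eval (n : ℤ)).natAbs.divisors) : ℝ) ≤ ∑ n ∈ T, F :=
          sum_le_sum fun n hn => hF n (mem_filter.1 hn).1
      _ = F * #T := by rw [sum_const, nsmul_eq_mul, mul_comm]
  refine h1.trans ?_
  rw [mul_assoc]
  refine mul_le_mul_of_nonneg_left ?_ hF0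
  -- Step 2: `T ⊆ ⋃_P {n : P^{e_P} ∣ g(n)}`
  set Pk := Nat.primesLE ⌊w⌋₊ with hPk
  set MP : ℕ → Finset ℕ := fun P => (Icc 1 N).filter (fun n : ℕ =>
    ((P ^ Shiu.ePow w P : ℕ) : ℤ) ∣ g.eval (n : ℤ)) with hMP
  have hsub : T ⊆ Pk.biUnion MP := by
    intro n hn
    rw [hT, mem_filter] at hn
    obtain ⟨hI, hzm, hPw, hcw⟩ := hn
    obtain ⟨hPp, hdvd⟩ := pow_ePow_dvd_of_classII hw hwz hzm hcw
    rw [mem_biUnion]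
    exact ⟨_, Nat.mem_primesLE.2 ⟨Nat.le_floor hPw, hPp⟩, mem_filter.2 ⟨hI, hdvd⟩⟩
  -- Step 3: count each `MP P`
  have hMP_card : ∀ P ∈ Pk, (#(MP P) : ℝ) ≤ W * ((N : ℝ) * ((P : ℝ) ^ Shiu.ePow w P)⁻¹ + 1) := by
    intro P hP
    obtain ⟨-, hPp⟩ := Nat.mem_primesLE.1 hP
    have hpos : 0 < P ^ Shiu.ePow w P := pow_pos hPp.pos _
    have h := card_Icc_filter_dvd_eval_le g hpos N
    have hρ : (polyRootCountMod ![g] (P ^ Shiu.ePow w P) : ℝ) ≤ W := hW P hPp _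
    have hq : (0 : ℝ) ≤ (N : ℝ) / (P ^ Shiu.ePow w P : ℕ) + 1 := by positivity
    calc (#(MP P) : ℝ) ≤ polyRootCountMod ![g] (P ^ Shiu.ePow w P) *
          ((N : ℝ) / (P ^ Shiu.ePow w P : ℕ) + 1) := h
      _ ≤ W * ((N : ℝ) / (P ^ Shiu.ePow w P : ℕ) + 1) := mul_le_mul_of_nonneg_right hρ hq
      _ = W * ((N : ℝ) * ((P : ℝ) ^ Shiu.ePow w P)⁻¹ + 1) := by
          push_cast
          rw [div_eq_mul_inv]
  -- Step 4: sum up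
  have hPk_card : (#Pk : ℝ) ≤ w := by
    have h1 : #Pk ≤ #(Icc 1 ⌊w⌋₊) := card_le_card fun P hP => by
      obtain ⟨hPw, hPp⟩ := Nat.mem_primesLE.1 hP
      exact mem_Icc.2 ⟨hPp.one_lt.le, hPw⟩
    rw [Nat.card_Icc, Nat.add_sub_cancel] at h1
    exact (Nat.cast_le.2 h1).trans (Nat.floor_le hw0.le)
  calc (#T : ℝ) ≤ #(Pk.biUnion MP) := by exact_mod_cast card_le_card hsub
    _ ≤ ∑ P ∈ Pk, (#(MP P) : ℝ) := by exact_mod_cast card_biUnion_le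
    _ ≤ ∑ P ∈ Pk, W * ((N : ℝ) * ((P : ℝ) ^ Shiu.ePow w P)⁻¹ + 1) := sum_le_sum hMP_card
    _ = W * ((N : ℝ) * ∑ P ∈ Pk, ((P : ℝ) ^ Shiu.ePow w P)⁻¹ + #Pk) := by
        rw [← mul_sum, sum_add_distrib, mul_sum, sum_const, nsmul_eq_mul, mul_one]
    _ ≤ W * ((N : ℝ) * (7 * w ^ (-(1 / 3 : ℝ))) + w) := by
        refine mul_le_mul_of_nonneg_left (add_le_add ?_ hPk_card) hW0
        exact mul_le_mul_of_nonneg_left (Shiu.sum_inv_pow_ePow_le hw1) (Nat.cast_nonneg N)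
    _ = W * (7 * (N : ℝ) * w ^ (-(1 / 3 : ℝ)) + w) := by ring

end ErdosDivisor

end Summit.Parity.BatemanHorn.Theorems
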